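import Literature.NumberTheory.EllipticCurves.Rank1Residual.X12SexticTwistTransportDischarge
import Literature.NumberTheory.EllipticCurves.HeegnerPointsRationality
import Literature.NumberTheory.EllipticCurves.HeegnerPointsProofs
import Literature.NumberTheory.QuadraticFields.ImaginaryQuadraticPrescribedSplitting
import Literature.NumberTheory.EllipticCurves.HeegnerPointsClassesProofs
import Literature.NumberTheory.EllipticCurves.KrizLi2019.SexticTwistAnalyticRank
import HarnessLib

/-!
# X12 at `p = 3`, Kriz–Li sextic-twist corner: the seven records WITHOUT Gross–Zagier data binders

HONEST FRAMING (cell `b2b-bsdres`, run/shared/lean/b2b/bsd-rank1-residual/; harvest seat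
`b2b-bsdres-harvest-1`, gen 5): prove what is provable now; shrink each hard class to its core with
data; no claim beyond stated classes. The cell deletes the COMBINATION-SHAPED residual classes of
the BSD formula in analytic rank `≤ 1` over `ℚ` from PUBLISHED theorems only and TYPES the
construction-shaped ones; announced preprints enter only as explicitly labelled OPEN hypotheses;
this is not "finishing BSD". Class X12 stays CONSTRUCTION-SHAPED; its Kriz–Li sub-population
(7 ‖ 151 pairs at `p = 3`) is FAMILY-shaped and closed in print.

Theorems only (no definition, no new named fact). The seven record theorems
`X12SexticTwist.bsdp_three_cremona<N>_of_discr` of `X12SexticTwistTransportDischarge.lean`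
(harvest seat 1 gen 4, on harvest seat 2's transports) still take as binders the Gross–Zagier
DATA: an imaginary quadratic field `K` with `d_K` pinned, a modular parametrisation datum `Dt` of
level `N` with `3 ∤ Dt.c` (Kriz–Li hypothesis (4): Manin constant prime to `3`), a Heegner datum
`H`, an embedding `ι : K → ℂ` and a `K`-rational point `P` over the complex Heegner point
(`hP`) — the b2b-bsdres referees' remaining bar (a) for booking the pairs (R72.2, R2-12.1:
"the GZ data instances `Dt` (level `N`, `3 ∤ c`), `H`, `ι`, `P` with `hP` — the tree's general GZK
bar"). This file replaces those data binders by the tree's PUBLISHED existence statements: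

* the field `K` EXISTS: `Quadratic.exists_numberField_discr_eq` (PROVED; Marcus Ch. 2 Thm. 1) for
  the fundamental discriminants `−11, −47, −23, −8`, imaginary by
  `Quadratic.isTotallyComplex_of_discr_neg` (PROVED);
* the residue `β` with `4N ∣ β² − d_K` EXISTS under the Heegner hypothesis:
  `exists_dvd_sq_sub_discr_holds` (PROVED); the Heegner hypothesis itself is the kernel theorem
  `heegner<N>_of_discr_<class>` of the gen-4 file;
* a Heegner datum with that `β` EXISTS: named fact `nonempty_heegnerDatum` (Gross 1984 §I.1;
  Gross–Kohnen–Zagier 1987 §I.1 — PUBLISHED);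
* an embedding `K → ℂ` exists (Mathlib);
* the Heegner point is `K`-rational for EVERY parametrisation datum and Heegner datum: named fact
  `heegnerPointComplex_mem_range_map` (Gross 1984 §§3–4; Gross–Zagier 1986 I.§4; Darmon 2004
  Thm. 3.6/3.7 — PUBLISHED; CM theory / Shimura reciprocity).
What REMAINS as an explicit per-pair input besides the published facts is exactly:
`∃ Dt : ModularParametrizationData …2 N, ¬ 3 ∣ Dt.c` — existence of a modular parametrisation of
the curve `…2` of level `N` whose Manin constant is prime to `3`. Existence of SOME parametrisation
of level `N = N(…2)` is modularity (named fact `nonempty_modularParametrizationData`, BCDT); that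
its constant can be taken prime to `3` is Kriz–Li's hypothesis (4), a CERTIFICATE VALUE: Cremona's
table `opt_man` (ecdata; J. Cremona, appendix to Agashe–Ribet–Stein, *The Manin constant*, PAMQ 2
(2006), Thm. 2.6 ff.) lists Manin constant `1` for both curves of each of the seven classes
(harvest seat 2, `KL19-X12-SEXTIC.md` §2). The other certificate values are unchanged:
`conductorNorm …2 = N`, side condition (i) `ord₃ Tam(…2Tw) = ord₃ Tam(…2)` (two implementations,
R2-12.1), `r_an(…1) = 1` (census). The GZ and Kolyvagin facts are taken for every `K` (they are
named facts quantified over the field anyway).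

ADDENDUM (harvest seat 1, gen 6 — theorems only): two of the remaining binders are themselves
discharged from the tree and from print. (a) `hHD : ∀ K, nonempty_heegnerDatum N K` is the tree
THEOREM `nonempty_heegnerDatum_holds` (`HeegnerPointsClassesProofs.lean`; referee nit
`x12closed-hHD-dischargeable`, REFEREE.md C103/R78.2). (b) `hr : r_an(…1) = 1` is NOT a census datum:
it is case (2) of Kriz–Li's **Corollary 10.7** (named fact
`KrizLi2019.cor107_analyticRank_sexticTwist`, `KrizLi2019/SexticTwistAnalyticRank.lean`: in the
situation of Theorem 10.6 — `K` Heegner for `3d`, (1) `d` fundamental, (2) `d ≡ 2 (mod 3)` or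
`≡ 3 (mod 9)`, (3) the `h₃`-conditions, NO Manin hypothesis — "if `d < 0` and `d ≡ 2 (mod 9)`, or
`d > 0` and `d ≡ 3, 5, 8 (mod 9)`, then `r_an(E_d/ℚ) = 1`"), which covers all seven
`d = 5, −7, 8, 12, 17, 21, 41`, read on the `ℚ`-isogenous optimal curve `…1 ~ …2 ≅ E_d` by the tree
theorem `analyticRank_eq_of_isIsogenous'` (Knapp Thm. 11.67); the field `K` and hypotheses (1)–(3)
are the same kernel theorems as before. The records `bsdp_three_cremona<N>_of_cor107` therefore
take: the published named facts (Kriz–Li Thm. 10.10 `h` AND Cor. 10.7 `h107`, Gross–Zagier,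
Kolyvagin, Heegner-point rationality — each for every `K` —, Burungale–Flach Cor. 2, modularity,
Cassels) and exactly THREE per-pair inputs: `hDt` (a level-`N` parametrisation of `…2` with Manin
constant prime to `3`: Agashe–Ribet–Stein 2006, appendix by Cremona, Thm. 5.2 — for `N < 60000`
the curve `…1` is optimal with constant `1` — transported along the normalised `3`-isogeny
`…1 → …2`, REFEREE.md R78.3 / REFEREE-2.md R2-17.2), `hN : N(…2) = N`, and side condition (i)
`htam`. Nothing else; no census datum is left in the statement.

References: Kriz–Li 2019 Thm. 1.23 = 10.10, Thm. 10.6, Cor. 10.7 [KrizLi2019]; Gross 1984 [Gross1984];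
Gross–Zagier 1986 [GrossZagier1986]; Darmon 2004 Thm. 3.6–3.7 [Darmon2004]; Knapp 1993 Thm. 11.67
[Knapp1993]; Agashe–Ribet–Stein 2006 Thm. 2.6 / appendix Thm. 5.2 [AgasheRibetStein2006];
Cremona 1997 / ecdata [Cremona1997]; cell files REFEREE.md R72.2/R74.3/R78.2–R78.4, REFEREE-2.md
R2-12.1/R2-17.2, `b2b-bsdres-harvest-2/KL19-X12-SEXTIC.md`, `b2b-bsdres-harvest-1/RECLASSIFY.md` §GEN-6.
-/

noncomputable section

open scoped Classical

open WeierstrassCurve NumberField Literature.NumberTheory.EllipticCurves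
  Literature.NumberTheory.EllipticCurves.ModularForms
  Literature.NumberTheory.EllipticCurves.KrizLi2019
  Literature.NumberTheory.QuadraticFields

namespace Literature.NumberTheory.EllipticCurves.Rank1Residual.X12SexticTwist

/-! ### The four imaginary quadratic fields exist (kernel) -/

/-- There is a quadratic number field of discriminant `−11` (fundamental: `−11 ≡ 1 (mod 4)`,
squarefree). [folklore] -/
theorem exists_field_discr_neg11 : ∃ (K : Type) (_ : Field K) (_ : NumberField K),
    Module.finrank ℚ K = 2 ∧ NumberField.discr K = -11 :=
  Quadratic.exists_numberField_discr_eq (Or.inl ⟨by norm_num,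
    (Int.prime_iff_natAbs_prime.mpr (by norm_num)).squarefree, by norm_num⟩)

/-- There is a quadratic number field of discriminant `−47`. [folklore] -/
theorem exists_field_discr_neg47 : ∃ (K : Type) (_ : Field K) (_ : NumberField K),
    Module.finrank ℚ K = 2 ∧ NumberField.discr K = -47 :=
  Quadratic.exists_numberField_discr_eq (Or.inl ⟨by norm_num,
    (Int.prime_iff_natAbs_prime.mpr (by norm_num)).squarefree, by norm_num⟩)

/-- There is a quadratic number field of discriminant `−23`. [folklore] -/
theorem exists_field_discr_neg23 : ∃ (K : Type) (_ : Field K) (_ : NumberField K),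
    Module.finrank ℚ K = 2 ∧ NumberField.discr K = -23 :=
  Quadratic.exists_numberField_discr_eq (Or.inl ⟨by norm_num,
    (Int.prime_iff_natAbs_prime.mpr (by norm_num)).squarefree, by norm_num⟩)

/-- There is a quadratic number field of discriminant `−8` (`= 4·(−2)`, `−2 ≡ 2 (mod 4)`
squarefree). [folklore] -/
theorem exists_field_discr_neg8 : ∃ (K : Type) (_ : Field K) (_ : NumberField K),
    Module.finrank ℚ K = 2 ∧ NumberField.discr K = -8 :=
  Quadratic.exists_numberField_discr_eq (Or.inr ⟨by norm_num, by norm_num,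
    by norm_num; exact (Int.prime_iff_natAbs_prime.mpr (by norm_num)).squarefree⟩)

/-! ### The Gross–Zagier data exist, given the two published existence facts -/

/-- **From the published existence facts to the GZ data.** For a curve `W/ℚ` (elliptic), a level
`N` and a quadratic field `K` of negative discriminant satisfying the Heegner hypothesis for `N`:
Gross's `nonempty_heegnerDatum` (a Heegner datum with any admissible `β`; `β` exists by the PROVED
`exists_dvd_sq_sub_discr_holds`) and the rationality fact `heegnerPointComplex_mem_range_map`
(the Heegner point of ANY parametrisation datum `Dt` is `K`-rational) give, for every `Dt`, a
Heegner datum `H`, an embedding `ι` and a point `P ∈ E(K)` over `heegnerPointComplex Dt H`.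
[cite: Gross1984, §I.1 and §§3–4] [cite: Darmon2004, Thm. 3.6 and §3.7] -/
theorem exists_heegner_data {N : ℕ} [NeZero N] {W : WeierstrassCurve ℚ} [W.IsElliptic]
    {K : Type} [Field K] [NumberField K]
    (hHD : nonempty_heegnerDatum N K) (hrat : heegnerPointComplex_mem_range_map N W K)
    (hK : IsImaginaryQuadratic K) (hH : SatisfiesHeegnerHypothesis N K)
    (Dt : ModularParametrizationData W N) :
    ∃ (H : HeegnerDatum N (NumberField.discr K)) (ι : K →+* ℂ) (P : (W.baseChange K).toAffine.Point),
      WeierstrassCurve.Affine.Point.map ι.toRatAlgHom P = heegnerPointComplex Dt H := by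
  obtain ⟨β, hβ⟩ := exists_dvd_sq_sub_discr_holds N K hK hH
  obtain ⟨H, -⟩ := hHD hK hβ
  obtain ⟨ι⟩ := (inferInstance : Nonempty (K →+* ℂ))
  obtain ⟨P, hP⟩ := hrat hK hH Dt H ι
  exact ⟨H, ι, P, hP⟩

/-! ### The seven records without data binders -/

/-- **225a** (`d = 5`; field `d_K = −11`): `BSD(225a1, 3)` (and `rank 225a2 = 1 ∧ BSD(225a2, 3)`)
from the PUBLISHED facts — Kriz–Li Thm. 10.10 (A48 `h`), Gross–Zagier and Kolyvagin (for every
`K`), Burungale–Flach Cor. 2, modularity, Cassels, Gross's existence of Heegner data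
(`nonempty_heegnerDatum`) and the `K`-rationality of Heegner points
(`heegnerPointComplex_mem_range_map`) — plus the certificate values: a level-`225`
parametrisation of `225a2` with Manin constant prime to `3` exists (`hDt`; Cremona `opt_man`:
constant `1`), `N(225a2) = 225`, side condition (i), `r_an(225a1) = 1`. The field `ℚ(√−11)`, the
residue `β`, the Heegner hypotheses for `15` and `225`, `3 ∤ #μ(K)` and Kriz–Li (1)–(3) are kernel
theorems. [cite: KrizLi2019, Thm. 1.23 = Thm. 10.10] [cite: Cremona1997, Table 1 (class 225a)] -/
theorem bsdp_three_cremona225a_closed (h : thm1010_bsdThree_overK_sexticTwist)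
    (hGZ : ∀ (K : Type) [Field K] [NumberField K], gross_zagier 225 cremona225a2 K)
    (hKo : ∀ (K : Type) [Field K] [NumberField K], kolyvagin 225 cremona225a2 K)
    (hHD : ∀ (K : Type) [Field K] [NumberField K], nonempty_heegnerDatum 225 K)
    (hrat : ∀ (K : Type) [Field K] [NumberField K],
      heegnerPointComplex_mem_range_map 225 cremona225a2 K)
    (hCM0 : bsdTriple_of_hasCM_of_L_one_ne_zero) (hmod : hasEntireLFunction_rat)
    (hCassels : bsdRHS_eq_of_isIsogenous)
    (hDt : ∃ Dt : ModularParametrizationData cremona225a2 225, ¬ (3 : ℤ) ∣ Dt.c)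
    (hN : cremona225a2.conductorNorm ℤ = 225)
    (htam : padicValNat 3 cremona225a2Tw.tamagawaProduct = padicValNat 3 cremona225a2.tamagawaProduct)
    (hr : cremona225a1.analyticRank = 1) :
    (cremona225a2.mordellWeilRank = 1 ∧ BSDp cremona225a2 3) ∧
      (cremona225a1.analyticRank = 1 ∧ BSDp cremona225a1 3) := by
  obtain ⟨K, _, _, h2, hD⟩ := exists_field_discr_neg11
  have hK : IsImaginaryQuadratic K :=
    ⟨h2, Quadratic.isTotallyComplex_of_discr_neg h2 (by rw [hD]; norm_num)⟩
  obtain ⟨Dt, h4⟩ := hDt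
  obtain ⟨H, ι, P, hP⟩ := exists_heegner_data (hHD K) (hrat K) hK (heegner225_of_discr_225a h2 hD) Dt
  exact bsdp_three_cremona225a_of_discr K Dt H ι P h (hGZ K) (hKo K) hCM0 hmod hCassels hK hD hP h4
    hN htam hr

/-- **1323m** (`d = −7`; `d_K = −47`): as `bsdp_three_cremona225a_closed`.
[cite: KrizLi2019, Thm. 1.23 = Thm. 10.10] [cite: Cremona1997, Table 1 (class 1323m)] -/
theorem bsdp_three_cremona1323m_closed (h : thm1010_bsdThree_overK_sexticTwist)
    (hGZ : ∀ (K : Type) [Field K] [NumberField K], gross_zagier 1323 cremona1323m2 K)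
    (hKo : ∀ (K : Type) [Field K] [NumberField K], kolyvagin 1323 cremona1323m2 K)
    (hHD : ∀ (K : Type) [Field K] [NumberField K], nonempty_heegnerDatum 1323 K)
    (hrat : ∀ (K : Type) [Field K] [NumberField K],
      heegnerPointComplex_mem_range_map 1323 cremona1323m2 K)
    (hCM0 : bsdTriple_of_hasCM_of_L_one_ne_zero) (hmod : hasEntireLFunction_rat)
    (hCassels : bsdRHS_eq_of_isIsogenous)
    (hDt : ∃ Dt : ModularParametrizationData cremona1323m2 1323, ¬ (3 : ℤ) ∣ Dt.c)
    (hN : cremona1323m2.conductorNorm ℤ = 1323)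
    (htam : padicValNat 3 cremona1323m2Tw.tamagawaProduct =
      padicValNat 3 cremona1323m2.tamagawaProduct)
    (hr : cremona1323m1.analyticRank = 1) :
    (cremona1323m2.mordellWeilRank = 1 ∧ BSDp cremona1323m2 3) ∧
      (cremona1323m1.analyticRank = 1 ∧ BSDp cremona1323m1 3) := by
  obtain ⟨K, _, _, h2, hD⟩ := exists_field_discr_neg47
  have hK : IsImaginaryQuadratic K :=
    ⟨h2, Quadratic.isTotallyComplex_of_discr_neg h2 (by rw [hD]; norm_num)⟩
  obtain ⟨Dt, h4⟩ := hDt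
  obtain ⟨H, ι, P, hP⟩ :=
    exists_heegner_data (hHD K) (hrat K) hK (heegner1323_of_discr_1323m h2 hD) Dt
  exact bsdp_three_cremona1323m_of_discr K Dt H ι P h (hGZ K) (hKo K) hCM0 hmod hCassels hK hD hP
    h4 hN htam hr

/-- **1728a** (`d = 8`; `d_K = −23`): as `bsdp_three_cremona225a_closed`.
[cite: KrizLi2019, Thm. 1.23 = Thm. 10.10] [cite: Cremona1997, Table 1 (class 1728a)] -/
theorem bsdp_three_cremona1728a_closed (h : thm1010_bsdThree_overK_sexticTwist)
    (hGZ : ∀ (K : Type) [Field K] [NumberField K], gross_zagier 1728 cremona1728a2 K)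
    (hKo : ∀ (K : Type) [Field K] [NumberField K], kolyvagin 1728 cremona1728a2 K)
    (hHD : ∀ (K : Type) [Field K] [NumberField K], nonempty_heegnerDatum 1728 K)
    (hrat : ∀ (K : Type) [Field K] [NumberField K],
      heegnerPointComplex_mem_range_map 1728 cremona1728a2 K)
    (hCM0 : bsdTriple_of_hasCM_of_L_one_ne_zero) (hmod : hasEntireLFunction_rat)
    (hCassels : bsdRHS_eq_of_isIsogenous)
    (hDt : ∃ Dt : ModularParametrizationData cremona1728a2 1728, ¬ (3 : ℤ) ∣ Dt.c)
    (hN : cremona1728a2.conductorNorm ℤ = 1728)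
    (htam : padicValNat 3 cremona1728a2Tw.tamagawaProduct =
      padicValNat 3 cremona1728a2.tamagawaProduct)
    (hr : cremona1728a1.analyticRank = 1) :
    (cremona1728a2.mordellWeilRank = 1 ∧ BSDp cremona1728a2 3) ∧
      (cremona1728a1.analyticRank = 1 ∧ BSDp cremona1728a1 3) := by
  obtain ⟨K, _, _, h2, hD⟩ := exists_field_discr_neg23
  have hK : IsImaginaryQuadratic K :=
    ⟨h2, Quadratic.isTotallyComplex_of_discr_neg h2 (by rw [hD]; norm_num)⟩
  obtain ⟨Dt, h4⟩ := hDt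
  obtain ⟨H, ι, P, hP⟩ :=
    exists_heegner_data (hHD K) (hrat K) hK (heegner1728_of_discr_1728a h2 hD) Dt
  exact bsdp_three_cremona1728a_of_discr K Dt H ι P h (hGZ K) (hKo K) hCM0 hmod hCassels hK hD hP
    h4 hN htam hr

/-- **3888t** (`d = 12`; `d_K = −23`): as `bsdp_three_cremona225a_closed`.
[cite: KrizLi2019, Thm. 1.23 = Thm. 10.10] [cite: Cremona1997, Table 1 (class 3888t)] -/
theorem bsdp_three_cremona3888t_closed (h : thm1010_bsdThree_overK_sexticTwist)
    (hGZ : ∀ (K : Type) [Field K] [NumberField K], gross_zagier 3888 cremona3888t2 K)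
    (hKo : ∀ (K : Type) [Field K] [NumberField K], kolyvagin 3888 cremona3888t2 K)
    (hHD : ∀ (K : Type) [Field K] [NumberField K], nonempty_heegnerDatum 3888 K)
    (hrat : ∀ (K : Type) [Field K] [NumberField K],
      heegnerPointComplex_mem_range_map 3888 cremona3888t2 K)
    (hCM0 : bsdTriple_of_hasCM_of_L_one_ne_zero) (hmod : hasEntireLFunction_rat)
    (hCassels : bsdRHS_eq_of_isIsogenous)
    (hDt : ∃ Dt : ModularParametrizationData cremona3888t2 3888, ¬ (3 : ℤ) ∣ Dt.c)
    (hN : cremona3888t2.conductorNorm ℤ = 3888)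
    (htam : padicValNat 3 cremona3888t2Tw.tamagawaProduct =
      padicValNat 3 cremona3888t2.tamagawaProduct)
    (hr : cremona3888t1.analyticRank = 1) :
    (cremona3888t2.mordellWeilRank = 1 ∧ BSDp cremona3888t2 3) ∧
      (cremona3888t1.analyticRank = 1 ∧ BSDp cremona3888t1 3) := by
  obtain ⟨K, _, _, h2, hD⟩ := exists_field_discr_neg23
  have hK : IsImaginaryQuadratic K :=
    ⟨h2, Quadratic.isTotallyComplex_of_discr_neg h2 (by rw [hD]; norm_num)⟩
  obtain ⟨Dt, h4⟩ := hDt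
  obtain ⟨H, ι, P, hP⟩ :=
    exists_heegner_data (hHD K) (hrat K) hK (heegner3888_of_discr_3888t h2 hD) Dt
  exact bsdp_three_cremona3888t_of_discr K Dt H ι P h (hGZ K) (hKo K) hCM0 hmod hCassels hK hD hP
    h4 hN htam hr

/-- **7803b** (`d = 17`; `d_K = −8`): as `bsdp_three_cremona225a_closed`.
[cite: KrizLi2019, Thm. 1.23 = Thm. 10.10] [cite: Cremona1997, Table 1 (class 7803b)] -/
theorem bsdp_three_cremona7803b_closed (h : thm1010_bsdThree_overK_sexticTwist)
    (hGZ : ∀ (K : Type) [Field K] [NumberField K], gross_zagier 7803 cremona7803b2 K)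
    (hKo : ∀ (K : Type) [Field K] [NumberField K], kolyvagin 7803 cremona7803b2 K)
    (hHD : ∀ (K : Type) [Field K] [NumberField K], nonempty_heegnerDatum 7803 K)
    (hrat : ∀ (K : Type) [Field K] [NumberField K],
      heegnerPointComplex_mem_range_map 7803 cremona7803b2 K)
    (hCM0 : bsdTriple_of_hasCM_of_L_one_ne_zero) (hmod : hasEntireLFunction_rat)
    (hCassels : bsdRHS_eq_of_isIsogenous)
    (hDt : ∃ Dt : ModularParametrizationData cremona7803b2 7803, ¬ (3 : ℤ) ∣ Dt.c)
    (hN : cremona7803b2.conductorNorm ℤ = 7803)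
    (htam : padicValNat 3 cremona7803b2Tw.tamagawaProduct =
      padicValNat 3 cremona7803b2.tamagawaProduct)
    (hr : cremona7803b1.analyticRank = 1) :
    (cremona7803b2.mordellWeilRank = 1 ∧ BSDp cremona7803b2 3) ∧
      (cremona7803b1.analyticRank = 1 ∧ BSDp cremona7803b1 3) := by
  obtain ⟨K, _, _, h2, hD⟩ := exists_field_discr_neg8
  have hK : IsImaginaryQuadratic K :=
    ⟨h2, Quadratic.isTotallyComplex_of_discr_neg h2 (by rw [hD]; norm_num)⟩
  obtain ⟨Dt, h4⟩ := hDt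
  obtain ⟨H, ι, P, hP⟩ :=
    exists_heegner_data (hHD K) (hrat K) hK (heegner7803_of_discr_7803b h2 hD) Dt
  exact bsdp_three_cremona7803b_of_discr K Dt H ι P h (hGZ K) (hKo K) hCM0 hmod hCassels hK hD hP
    h4 hN htam hr

/-- **11907s** (`d = 21`; `d_K = −47`): as `bsdp_three_cremona225a_closed`.
[cite: KrizLi2019, Thm. 1.23 = Thm. 10.10] [cite: Cremona1997, Table 1 (class 11907s)] -/
theorem bsdp_three_cremona11907s_closed (h : thm1010_bsdThree_overK_sexticTwist)
    (hGZ : ∀ (K : Type) [Field K] [NumberField K], gross_zagier 11907 cremona11907s2 K)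
    (hKo : ∀ (K : Type) [Field K] [NumberField K], kolyvagin 11907 cremona11907s2 K)
    (hHD : ∀ (K : Type) [Field K] [NumberField K], nonempty_heegnerDatum 11907 K)
    (hrat : ∀ (K : Type) [Field K] [NumberField K],
      heegnerPointComplex_mem_range_map 11907 cremona11907s2 K)
    (hCM0 : bsdTriple_of_hasCM_of_L_one_ne_zero) (hmod : hasEntireLFunction_rat)
    (hCassels : bsdRHS_eq_of_isIsogenous)
    (hDt : ∃ Dt : ModularParametrizationData cremona11907s2 11907, ¬ (3 : ℤ) ∣ Dt.c)
    (hN : cremona11907s2.conductorNorm ℤ = 11907)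
    (htam : padicValNat 3 cremona11907s2Tw.tamagawaProduct =
      padicValNat 3 cremona11907s2.tamagawaProduct)
    (hr : cremona11907s1.analyticRank = 1) :
    (cremona11907s2.mordellWeilRank = 1 ∧ BSDp cremona11907s2 3) ∧
      (cremona11907s1.analyticRank = 1 ∧ BSDp cremona11907s1 3) := by
  obtain ⟨K, _, _, h2, hD⟩ := exists_field_discr_neg47
  have hK : IsImaginaryQuadratic K :=
    ⟨h2, Quadratic.isTotallyComplex_of_discr_neg h2 (by rw [hD]; norm_num)⟩
  obtain ⟨Dt, h4⟩ := hDt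
  obtain ⟨H, ι, P, hP⟩ :=
    exists_heegner_data (hHD K) (hrat K) hK (heegner11907_of_discr_11907s h2 hD) Dt
  exact bsdp_three_cremona11907s_of_discr K Dt H ι P h (hGZ K) (hKo K) hCM0 hmod hCassels hK hD
    hP h4 hN htam hr

/-- **15129a** (`d = 41`; `d_K = −8`): as `bsdp_three_cremona225a_closed`.
[cite: KrizLi2019, Thm. 1.23 = Thm. 10.10] [cite: Cremona1997, Table 1 (class 15129a)] -/
theorem bsdp_three_cremona15129a_closed (h : thm1010_bsdThree_overK_sexticTwist)
    (hGZ : ∀ (K : Type) [Field K] [NumberField K], gross_zagier 15129 cremona15129a2 K)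
    (hKo : ∀ (K : Type) [Field K] [NumberField K], kolyvagin 15129 cremona15129a2 K)
    (hHD : ∀ (K : Type) [Field K] [NumberField K], nonempty_heegnerDatum 15129 K)
    (hrat : ∀ (K : Type) [Field K] [NumberField K],
      heegnerPointComplex_mem_range_map 15129 cremona15129a2 K)
    (hCM0 : bsdTriple_of_hasCM_of_L_one_ne_zero) (hmod : hasEntireLFunction_rat)
    (hCassels : bsdRHS_eq_of_isIsogenous)
    (hDt : ∃ Dt : ModularParametrizationData cremona15129a2 15129, ¬ (3 : ℤ) ∣ Dt.c)
    (hN : cremona15129a2.conductorNorm ℤ = 15129)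
    (htam : padicValNat 3 cremona15129a2Tw.tamagawaProduct =
      padicValNat 3 cremona15129a2.tamagawaProduct)
    (hr : cremona15129a1.analyticRank = 1) :
    (cremona15129a2.mordellWeilRank = 1 ∧ BSDp cremona15129a2 3) ∧
      (cremona15129a1.analyticRank = 1 ∧ BSDp cremona15129a1 3) := by
  obtain ⟨K, _, _, h2, hD⟩ := exists_field_discr_neg8
  have hK : IsImaginaryQuadratic K :=
    ⟨h2, Quadratic.isTotallyComplex_of_discr_neg h2 (by rw [hD]; norm_num)⟩
  obtain ⟨Dt, h4⟩ := hDt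
  obtain ⟨H, ι, P, hP⟩ :=
    exists_heegner_data (hHD K) (hrat K) hK (heegner15129_of_discr_15129a h2 hD) Dt
  exact bsdp_three_cremona15129a_of_discr K Dt H ι P h (hGZ K) (hKo K) hCM0 hmod hCassels hK hD
    hP h4 hN htam hr

/-! ### ADDENDUM (gen 6): `hHD` is a tree theorem and `hr` is Kriz–Li Cor. 10.7 (2) — the seven records with three per-pair inputs -/

/-- **`r_an(…1) = 1` from print.** For `W₁ ~ W₂ ≅ E_d` (`ℚ`-isogenous, `W₂` a model of
`y² = x³ − 432d`) and `K`, `d` in the situation of Kriz–Li's Theorem 10.6, case (2) of Corollary 10.7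
(`d < 0, d ≡ 2 (mod 9)` or `d > 0, d ≡ 3, 5, 8 (mod 9)`) gives `r_an(W₂) = 1`, and isogenous curves
have the same `L`-function (Knapp Thm. 11.67, tree theorem `analyticRank_eq_of_isIsogenous'`), so
`r_an(W₁) = 1`. [cite: KrizLi2019, Cor. 10.7 (2)] [cite: Knapp1993, Thm. 11.67] -/
theorem analyticRank_eq_one_of_cor107_of_isIsogenous (h107 : cor107_analyticRank_sexticTwist)
    (d : ℤ) {W₁ W₂ : WeierstrassCurve ℚ} [W₁.IsElliptic] [W₂.IsElliptic]
    (K : Type) [Field K] [NumberField K] (hiso : IsIsogenous W₁ W₂)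
    (hW : ∃ C : VariableChange ℚ, C • W₂ = ({ a₁ := 0, a₂ := 0, a₃ := 0, a₄ := 0, a₆ := -432 * d } :
      WeierstrassCurve ℚ))
    (hK : IsImaginaryQuadratic K) (hH : SatisfiesHeegnerHypothesis (3 * d.natAbs) K)
    (h1 : (d % 4 = 1 ∧ Squarefree d ∧ d ≠ 1) ∨
      (4 ∣ d ∧ (d / 4 % 4 = 2 ∨ d / 4 % 4 = 3) ∧ Squarefree (d / 4)))
    (h2 : d % 3 = 2 ∨ d % 9 = 3)
    (h3pos : 0 < d → ThreeClassNumberTrivial (-3 * d) ∧ ThreeClassNumberTrivial (NumberField.discr K * d))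
    (h3neg : d < 0 → ThreeClassNumberTrivial d ∧ ThreeClassNumberTrivial (-3 * NumberField.discr K * d))
    (hcase : d < 0 ∧ d % 9 = 2 ∨ 0 < d ∧ (d % 9 = 3 ∨ d % 9 = 5 ∨ d % 9 = 8)) :
    W₁.analyticRank = 1 :=
  (analyticRank_eq_of_isIsogenous' hiso).trans
    (analyticRank_eq_one_of_cor107 h107 d W₂ K hW hK hH h1 h2 h3pos h3neg hcase)

/-- **225a** (`d = 5`; `d_K = -11`): `(rank 225a2 = 1 ∧ BSD(225a2, 3)) ∧ (r_an 225a1 = 1 ∧ BSD(225a1, 3))`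
from the PUBLISHED facts — Kriz–Li Thm. 10.10 (`h`) and Cor. 10.7 (`h107`), Gross–Zagier, Kolyvagin and
the `K`-rationality of Heegner points (for every `K`), Burungale–Flach Cor. 2, modularity, Cassels —
and exactly THREE per-pair inputs: `hDt` (a level-`225` parametrisation of `225a2` with Manin constant
prime to `3`: ARS 2006 Thm. 5.2 + the normalised `3`-isogeny `225a1 → 225a2`), `hN : N(225a2) = 225`,
side condition (i) `htam`. As `bsdp_three_cremona225a_closed` with `hHD` discharged by
`nonempty_heegnerDatum_holds` and `hr` by Cor. 10.7 (2) at `d = 5` on `225a1 ~ 225a2 ≅ E_{5}`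
(field `d_K = -11`, Heegner for `3·5`, (1)–(3) kernel theorems).
[cite: KrizLi2019, Thm. 1.23 = Thm. 10.10 and Cor. 10.7 (2)] [cite: AgasheRibetStein2006, Thm. 5.2 (appendix)] [cite: Cremona1997, Table 1 (class 225a)] -/
theorem bsdp_three_cremona225a_of_cor107 (h : thm1010_bsdThree_overK_sexticTwist)
    (h107 : cor107_analyticRank_sexticTwist)
    (hGZ : ∀ (K : Type) [Field K] [NumberField K], gross_zagier 225 cremona225a2 K)
    (hKo : ∀ (K : Type) [Field K] [NumberField K], kolyvagin 225 cremona225a2 K)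
    (hrat : ∀ (K : Type) [Field K] [NumberField K],
      heegnerPointComplex_mem_range_map 225 cremona225a2 K)
    (hCM0 : bsdTriple_of_hasCM_of_L_one_ne_zero) (hmod : hasEntireLFunction_rat)
    (hCassels : bsdRHS_eq_of_isIsogenous)
    (hDt : ∃ Dt : ModularParametrizationData cremona225a2 225, ¬ (3 : ℤ) ∣ Dt.c)
    (hN : cremona225a2.conductorNorm ℤ = 225)
    (htam : padicValNat 3 cremona225a2Tw.tamagawaProduct = padicValNat 3 cremona225a2.tamagawaProduct) :
    (cremona225a2.mordellWeilRank = 1 ∧ BSDp cremona225a2 3) ∧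
      (cremona225a1.analyticRank = 1 ∧ BSDp cremona225a1 3) := by
  haveI : NeZero (225 : ℕ) := ⟨by norm_num⟩
  obtain ⟨K, _, _, h2, hD⟩ := exists_field_discr_neg11
  have hK : IsImaginaryQuadratic K :=
    ⟨h2, Quadratic.isTotallyComplex_of_discr_neg h2 (by rw [hD]; norm_num)⟩
  have hr : cremona225a1.analyticRank = 1 :=
    analyticRank_eq_one_of_cor107_of_isIsogenous h107 (5) K isIsogenous_cremona225a cremona225a2_eq hK
      (by simpa using heegner15_of_discr_225a h2 hD)
      (Or.inl ⟨by norm_num, by exact_mod_cast squarefree_intCast_of_prime (by norm_num : Nat.Prime 5),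
        by norm_num⟩)
      (by norm_num)
      (fun _ => ⟨by norm_num; exact threeClassNumberTrivial_neg15,
        by rw [hD]; norm_num; exact threeClassNumberTrivial_neg55⟩) (fun h => absurd h (by norm_num))
      (by norm_num)
  exact bsdp_three_cremona225a_closed h hGZ hKo (fun K _ _ => nonempty_heegnerDatum_holds 225 K) hrat hCM0
    hmod hCassels hDt hN htam hr

/-- **1323m** (`d = -7`; `d_K = -47`): `(rank 1323m2 = 1 ∧ BSD(1323m2, 3)) ∧ (r_an 1323m1 = 1 ∧ BSD(1323m1, 3))`
from the PUBLISHED facts — Kriz–Li Thm. 10.10 (`h`) and Cor. 10.7 (`h107`), Gross–Zagier, Kolyvagin and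
the `K`-rationality of Heegner points (for every `K`), Burungale–Flach Cor. 2, modularity, Cassels —
and exactly THREE per-pair inputs: `hDt` (a level-`1323` parametrisation of `1323m2` with Manin constant
prime to `3`: ARS 2006 Thm. 5.2 + the normalised `3`-isogeny `1323m1 → 1323m2`), `hN : N(1323m2) = 1323`,
side condition (i) `htam`. As `bsdp_three_cremona1323m_closed` with `hHD` discharged by
`nonempty_heegnerDatum_holds` and `hr` by Cor. 10.7 (2) at `d = -7` on `1323m1 ~ 1323m2 ≅ E_{-7}`
(field `d_K = -47`, Heegner for `3·7`, (1)–(3) kernel theorems).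
[cite: KrizLi2019, Thm. 1.23 = Thm. 10.10 and Cor. 10.7 (2)] [cite: AgasheRibetStein2006, Thm. 5.2 (appendix)] [cite: Cremona1997, Table 1 (class 1323m)] -/
theorem bsdp_three_cremona1323m_of_cor107 (h : thm1010_bsdThree_overK_sexticTwist)
    (h107 : cor107_analyticRank_sexticTwist)
    (hGZ : ∀ (K : Type) [Field K] [NumberField K], gross_zagier 1323 cremona1323m2 K)
    (hKo : ∀ (K : Type) [Field K] [NumberField K], kolyvagin 1323 cremona1323m2 K)
    (hrat : ∀ (K : Type) [Field K] [NumberField K],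
      heegnerPointComplex_mem_range_map 1323 cremona1323m2 K)
    (hCM0 : bsdTriple_of_hasCM_of_L_one_ne_zero) (hmod : hasEntireLFunction_rat)
    (hCassels : bsdRHS_eq_of_isIsogenous)
    (hDt : ∃ Dt : ModularParametrizationData cremona1323m2 1323, ¬ (3 : ℤ) ∣ Dt.c)
    (hN : cremona1323m2.conductorNorm ℤ = 1323)
    (htam : padicValNat 3 cremona1323m2Tw.tamagawaProduct = padicValNat 3 cremona1323m2.tamagawaProduct) :
    (cremona1323m2.mordellWeilRank = 1 ∧ BSDp cremona1323m2 3) ∧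
      (cremona1323m1.analyticRank = 1 ∧ BSDp cremona1323m1 3) := by
  haveI : NeZero (1323 : ℕ) := ⟨by norm_num⟩
  obtain ⟨K, _, _, h2, hD⟩ := exists_field_discr_neg47
  have hK : IsImaginaryQuadratic K :=
    ⟨h2, Quadratic.isTotallyComplex_of_discr_neg h2 (by rw [hD]; norm_num)⟩
  have hr : cremona1323m1.analyticRank = 1 :=
    analyticRank_eq_one_of_cor107_of_isIsogenous h107 (-7) K isIsogenous_cremona1323m cremona1323m2_eq hK
      (by simpa using heegner21_of_discr_1323m h2 hD)
      (Or.inl ⟨by norm_num, Int.squarefree_natAbs.mp (by simpa using (Nat.prime_iff.mp (by norm_num : Nat.Prime 7)).squarefree),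
        by norm_num⟩)
      (by norm_num)
      (fun h => absurd h (by norm_num))
      (fun _ => ⟨threeClassNumberTrivial_neg7, by rw [hD]; norm_num; exact threeClassNumberTrivial_neg987⟩)
      (by norm_num)
  exact bsdp_three_cremona1323m_closed h hGZ hKo (fun K _ _ => nonempty_heegnerDatum_holds 1323 K) hrat hCM0
    hmod hCassels hDt hN htam hr

/-- **1728a** (`d = 8`; `d_K = -23`): `(rank 1728a2 = 1 ∧ BSD(1728a2, 3)) ∧ (r_an 1728a1 = 1 ∧ BSD(1728a1, 3))`
from the PUBLISHED facts — Kriz–Li Thm. 10.10 (`h`) and Cor. 10.7 (`h107`), Gross–Zagier, Kolyvagin and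
the `K`-rationality of Heegner points (for every `K`), Burungale–Flach Cor. 2, modularity, Cassels —
and exactly THREE per-pair inputs: `hDt` (a level-`1728` parametrisation of `1728a2` with Manin constant
prime to `3`: ARS 2006 Thm. 5.2 + the normalised `3`-isogeny `1728a1 → 1728a2`), `hN : N(1728a2) = 1728`,
side condition (i) `htam`. As `bsdp_three_cremona1728a_closed` with `hHD` discharged by
`nonempty_heegnerDatum_holds` and `hr` by Cor. 10.7 (2) at `d = 8` on `1728a1 ~ 1728a2 ≅ E_{8}`
(field `d_K = -23`, Heegner for `3·8`, (1)–(3) kernel theorems).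
[cite: KrizLi2019, Thm. 1.23 = Thm. 10.10 and Cor. 10.7 (2)] [cite: AgasheRibetStein2006, Thm. 5.2 (appendix)] [cite: Cremona1997, Table 1 (class 1728a)] -/
theorem bsdp_three_cremona1728a_of_cor107 (h : thm1010_bsdThree_overK_sexticTwist)
    (h107 : cor107_analyticRank_sexticTwist)
    (hGZ : ∀ (K : Type) [Field K] [NumberField K], gross_zagier 1728 cremona1728a2 K)
    (hKo : ∀ (K : Type) [Field K] [NumberField K], kolyvagin 1728 cremona1728a2 K)
    (hrat : ∀ (K : Type) [Field K] [NumberField K],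
      heegnerPointComplex_mem_range_map 1728 cremona1728a2 K)
    (hCM0 : bsdTriple_of_hasCM_of_L_one_ne_zero) (hmod : hasEntireLFunction_rat)
    (hCassels : bsdRHS_eq_of_isIsogenous)
    (hDt : ∃ Dt : ModularParametrizationData cremona1728a2 1728, ¬ (3 : ℤ) ∣ Dt.c)
    (hN : cremona1728a2.conductorNorm ℤ = 1728)
    (htam : padicValNat 3 cremona1728a2Tw.tamagawaProduct = padicValNat 3 cremona1728a2.tamagawaProduct) :
    (cremona1728a2.mordellWeilRank = 1 ∧ BSDp cremona1728a2 3) ∧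
      (cremona1728a1.analyticRank = 1 ∧ BSDp cremona1728a1 3) := by
  haveI : NeZero (1728 : ℕ) := ⟨by norm_num⟩
  obtain ⟨K, _, _, h2, hD⟩ := exists_field_discr_neg23
  have hK : IsImaginaryQuadratic K :=
    ⟨h2, Quadratic.isTotallyComplex_of_discr_neg h2 (by rw [hD]; norm_num)⟩
  have hr : cremona1728a1.analyticRank = 1 :=
    analyticRank_eq_one_of_cor107_of_isIsogenous h107 (8) K isIsogenous_cremona1728a cremona1728a2_eq hK
      (by simpa using heegner24_of_discr_1728a h2 hD)
      (Or.inr ⟨by norm_num, Or.inl (by norm_num),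
        by rw [show (8 : ℤ) / 4 = 2 by norm_num]; exact_mod_cast squarefree_intCast_of_prime Nat.prime_two⟩)
      (by norm_num)
      (fun _ => ⟨by norm_num; exact threeClassNumberTrivial_neg24,
        by rw [hD]; norm_num; exact threeClassNumberTrivial_neg184⟩) (fun h => absurd h (by norm_num))
      (by norm_num)
  exact bsdp_three_cremona1728a_closed h hGZ hKo (fun K _ _ => nonempty_heegnerDatum_holds 1728 K) hrat hCM0
    hmod hCassels hDt hN htam hr

/-- **3888t** (`d = 12`; `d_K = -23`): `(rank 3888t2 = 1 ∧ BSD(3888t2, 3)) ∧ (r_an 3888t1 = 1 ∧ BSD(3888t1, 3))`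
from the PUBLISHED facts — Kriz–Li Thm. 10.10 (`h`) and Cor. 10.7 (`h107`), Gross–Zagier, Kolyvagin and
the `K`-rationality of Heegner points (for every `K`), Burungale–Flach Cor. 2, modularity, Cassels —
and exactly THREE per-pair inputs: `hDt` (a level-`3888` parametrisation of `3888t2` with Manin constant
prime to `3`: ARS 2006 Thm. 5.2 + the normalised `3`-isogeny `3888t1 → 3888t2`), `hN : N(3888t2) = 3888`,
side condition (i) `htam`. As `bsdp_three_cremona3888t_closed` with `hHD` discharged by
`nonempty_heegnerDatum_holds` and `hr` by Cor. 10.7 (2) at `d = 12` on `3888t1 ~ 3888t2 ≅ E_{12}`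
(field `d_K = -23`, Heegner for `3·12`, (1)–(3) kernel theorems).
[cite: KrizLi2019, Thm. 1.23 = Thm. 10.10 and Cor. 10.7 (2)] [cite: AgasheRibetStein2006, Thm. 5.2 (appendix)] [cite: Cremona1997, Table 1 (class 3888t)] -/
theorem bsdp_three_cremona3888t_of_cor107 (h : thm1010_bsdThree_overK_sexticTwist)
    (h107 : cor107_analyticRank_sexticTwist)
    (hGZ : ∀ (K : Type) [Field K] [NumberField K], gross_zagier 3888 cremona3888t2 K)
    (hKo : ∀ (K : Type) [Field K] [NumberField K], kolyvagin 3888 cremona3888t2 K)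
    (hrat : ∀ (K : Type) [Field K] [NumberField K],
      heegnerPointComplex_mem_range_map 3888 cremona3888t2 K)
    (hCM0 : bsdTriple_of_hasCM_of_L_one_ne_zero) (hmod : hasEntireLFunction_rat)
    (hCassels : bsdRHS_eq_of_isIsogenous)
    (hDt : ∃ Dt : ModularParametrizationData cremona3888t2 3888, ¬ (3 : ℤ) ∣ Dt.c)
    (hN : cremona3888t2.conductorNorm ℤ = 3888)
    (htam : padicValNat 3 cremona3888t2Tw.tamagawaProduct = padicValNat 3 cremona3888t2.tamagawaProduct) :
    (cremona3888t2.mordellWeilRank = 1 ∧ BSDp cremona3888t2 3) ∧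
      (cremona3888t1.analyticRank = 1 ∧ BSDp cremona3888t1 3) := by
  haveI : NeZero (3888 : ℕ) := ⟨by norm_num⟩
  obtain ⟨K, _, _, h2, hD⟩ := exists_field_discr_neg23
  have hK : IsImaginaryQuadratic K :=
    ⟨h2, Quadratic.isTotallyComplex_of_discr_neg h2 (by rw [hD]; norm_num)⟩
  have hr : cremona3888t1.analyticRank = 1 :=
    analyticRank_eq_one_of_cor107_of_isIsogenous h107 (12) K isIsogenous_cremona3888t cremona3888t2_eq hK
      (by simpa using heegner36_of_discr_3888t h2 hD)
      (Or.inr ⟨by norm_num, Or.inr (by norm_num),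
        by rw [show (12 : ℤ) / 4 = 3 by norm_num]; exact_mod_cast squarefree_intCast_of_prime Nat.prime_three⟩)
      (by norm_num)
      (fun _ => ⟨by norm_num; exact threeClassNumberTrivial_neg36,
        by rw [hD]; norm_num; exact threeClassNumberTrivial_neg276⟩) (fun h => absurd h (by norm_num))
      (by norm_num)
  exact bsdp_three_cremona3888t_closed h hGZ hKo (fun K _ _ => nonempty_heegnerDatum_holds 3888 K) hrat hCM0
    hmod hCassels hDt hN htam hr

/-- **7803b** (`d = 17`; `d_K = -8`): `(rank 7803b2 = 1 ∧ BSD(7803b2, 3)) ∧ (r_an 7803b1 = 1 ∧ BSD(7803b1, 3))`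
from the PUBLISHED facts — Kriz–Li Thm. 10.10 (`h`) and Cor. 10.7 (`h107`), Gross–Zagier, Kolyvagin and
the `K`-rationality of Heegner points (for every `K`), Burungale–Flach Cor. 2, modularity, Cassels —
and exactly THREE per-pair inputs: `hDt` (a level-`7803` parametrisation of `7803b2` with Manin constant
prime to `3`: ARS 2006 Thm. 5.2 + the normalised `3`-isogeny `7803b1 → 7803b2`), `hN : N(7803b2) = 7803`,
side condition (i) `htam`. As `bsdp_three_cremona7803b_closed` with `hHD` discharged by
`nonempty_heegnerDatum_holds` and `hr` by Cor. 10.7 (2) at `d = 17` on `7803b1 ~ 7803b2 ≅ E_{17}`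
(field `d_K = -8`, Heegner for `3·17`, (1)–(3) kernel theorems).
[cite: KrizLi2019, Thm. 1.23 = Thm. 10.10 and Cor. 10.7 (2)] [cite: AgasheRibetStein2006, Thm. 5.2 (appendix)] [cite: Cremona1997, Table 1 (class 7803b)] -/
theorem bsdp_three_cremona7803b_of_cor107 (h : thm1010_bsdThree_overK_sexticTwist)
    (h107 : cor107_analyticRank_sexticTwist)
    (hGZ : ∀ (K : Type) [Field K] [NumberField K], gross_zagier 7803 cremona7803b2 K)
    (hKo : ∀ (K : Type) [Field K] [NumberField K], kolyvagin 7803 cremona7803b2 K)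
    (hrat : ∀ (K : Type) [Field K] [NumberField K],
      heegnerPointComplex_mem_range_map 7803 cremona7803b2 K)
    (hCM0 : bsdTriple_of_hasCM_of_L_one_ne_zero) (hmod : hasEntireLFunction_rat)
    (hCassels : bsdRHS_eq_of_isIsogenous)
    (hDt : ∃ Dt : ModularParametrizationData cremona7803b2 7803, ¬ (3 : ℤ) ∣ Dt.c)
    (hN : cremona7803b2.conductorNorm ℤ = 7803)
    (htam : padicValNat 3 cremona7803b2Tw.tamagawaProduct = padicValNat 3 cremona7803b2.tamagawaProduct) :
    (cremona7803b2.mordellWeilRank = 1 ∧ BSDp cremona7803b2 3) ∧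
      (cremona7803b1.analyticRank = 1 ∧ BSDp cremona7803b1 3) := by
  haveI : NeZero (7803 : ℕ) := ⟨by norm_num⟩
  obtain ⟨K, _, _, h2, hD⟩ := exists_field_discr_neg8
  have hK : IsImaginaryQuadratic K :=
    ⟨h2, Quadratic.isTotallyComplex_of_discr_neg h2 (by rw [hD]; norm_num)⟩
  have hr : cremona7803b1.analyticRank = 1 :=
    analyticRank_eq_one_of_cor107_of_isIsogenous h107 (17) K isIsogenous_cremona7803b cremona7803b2_eq hK
      (by simpa using heegner51_of_discr_7803b h2 hD)
      (Or.inl ⟨by norm_num, by exact_mod_cast squarefree_intCast_of_prime (by norm_num : Nat.Prime 17),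
        by norm_num⟩)
      (by norm_num)
      (fun _ => ⟨by norm_num; exact threeClassNumberTrivial_neg51,
        by rw [hD]; norm_num; exact threeClassNumberTrivial_neg136⟩) (fun h => absurd h (by norm_num))
      (by norm_num)
  exact bsdp_three_cremona7803b_closed h hGZ hKo (fun K _ _ => nonempty_heegnerDatum_holds 7803 K) hrat hCM0
    hmod hCassels hDt hN htam hr

/-- **11907s** (`d = 21`; `d_K = -47`): `(rank 11907s2 = 1 ∧ BSD(11907s2, 3)) ∧ (r_an 11907s1 = 1 ∧ BSD(11907s1, 3))`
from the PUBLISHED facts — Kriz–Li Thm. 10.10 (`h`) and Cor. 10.7 (`h107`), Gross–Zagier, Kolyvagin and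
the `K`-rationality of Heegner points (for every `K`), Burungale–Flach Cor. 2, modularity, Cassels —
and exactly THREE per-pair inputs: `hDt` (a level-`11907` parametrisation of `11907s2` with Manin constant
prime to `3`: ARS 2006 Thm. 5.2 + the normalised `3`-isogeny `11907s1 → 11907s2`), `hN : N(11907s2) = 11907`,
side condition (i) `htam`. As `bsdp_three_cremona11907s_closed` with `hHD` discharged by
`nonempty_heegnerDatum_holds` and `hr` by Cor. 10.7 (2) at `d = 21` on `11907s1 ~ 11907s2 ≅ E_{21}`
(field `d_K = -47`, Heegner for `3·21`, (1)–(3) kernel theorems).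
[cite: KrizLi2019, Thm. 1.23 = Thm. 10.10 and Cor. 10.7 (2)] [cite: AgasheRibetStein2006, Thm. 5.2 (appendix)] [cite: Cremona1997, Table 1 (class 11907s)] -/
theorem bsdp_three_cremona11907s_of_cor107 (h : thm1010_bsdThree_overK_sexticTwist)
    (h107 : cor107_analyticRank_sexticTwist)
    (hGZ : ∀ (K : Type) [Field K] [NumberField K], gross_zagier 11907 cremona11907s2 K)
    (hKo : ∀ (K : Type) [Field K] [NumberField K], kolyvagin 11907 cremona11907s2 K)
    (hrat : ∀ (K : Type) [Field K] [NumberField K],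
      heegnerPointComplex_mem_range_map 11907 cremona11907s2 K)
    (hCM0 : bsdTriple_of_hasCM_of_L_one_ne_zero) (hmod : hasEntireLFunction_rat)
    (hCassels : bsdRHS_eq_of_isIsogenous)
    (hDt : ∃ Dt : ModularParametrizationData cremona11907s2 11907, ¬ (3 : ℤ) ∣ Dt.c)
    (hN : cremona11907s2.conductorNorm ℤ = 11907)
    (htam : padicValNat 3 cremona11907s2Tw.tamagawaProduct = padicValNat 3 cremona11907s2.tamagawaProduct) :
    (cremona11907s2.mordellWeilRank = 1 ∧ BSDp cremona11907s2 3) ∧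
      (cremona11907s1.analyticRank = 1 ∧ BSDp cremona11907s1 3) := by
  haveI : NeZero (11907 : ℕ) := ⟨by norm_num⟩
  obtain ⟨K, _, _, h2, hD⟩ := exists_field_discr_neg47
  have hK : IsImaginaryQuadratic K :=
    ⟨h2, Quadratic.isTotallyComplex_of_discr_neg h2 (by rw [hD]; norm_num)⟩
  have hr : cremona11907s1.analyticRank = 1 :=
    analyticRank_eq_one_of_cor107_of_isIsogenous h107 (21) K isIsogenous_cremona11907s cremona11907s2_eq hK
      (by simpa using heegner63_of_discr_11907s h2 hD)
      (Or.inl ⟨by norm_num, by exact_mod_cast Int.squarefree_natCast.mpr ((show (21 : ℕ) = 3 * 7 by norm_num) ▸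
        (Nat.squarefree_mul (by norm_num)).mpr ⟨(Nat.prime_iff.mp Nat.prime_three).squarefree,
          (Nat.prime_iff.mp (by norm_num : Nat.Prime 7)).squarefree⟩), by norm_num⟩)
      (by norm_num)
      (fun _ => ⟨by norm_num; exact threeClassNumberTrivial_neg63,
        by rw [hD]; norm_num; exact threeClassNumberTrivial_neg987⟩) (fun h => absurd h (by norm_num))
      (by norm_num)
  exact bsdp_three_cremona11907s_closed h hGZ hKo (fun K _ _ => nonempty_heegnerDatum_holds 11907 K) hrat hCM0
    hmod hCassels hDt hN htam hr

/-- **15129a** (`d = 41`; `d_K = -8`): `(rank 15129a2 = 1 ∧ BSD(15129a2, 3)) ∧ (r_an 15129a1 = 1 ∧ BSD(15129a1, 3))`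
from the PUBLISHED facts — Kriz–Li Thm. 10.10 (`h`) and Cor. 10.7 (`h107`), Gross–Zagier, Kolyvagin and
the `K`-rationality of Heegner points (for every `K`), Burungale–Flach Cor. 2, modularity, Cassels —
and exactly THREE per-pair inputs: `hDt` (a level-`15129` parametrisation of `15129a2` with Manin constant
prime to `3`: ARS 2006 Thm. 5.2 + the normalised `3`-isogeny `15129a1 → 15129a2`), `hN : N(15129a2) = 15129`,
side condition (i) `htam`. As `bsdp_three_cremona15129a_closed` with `hHD` discharged by
`nonempty_heegnerDatum_holds` and `hr` by Cor. 10.7 (2) at `d = 41` on `15129a1 ~ 15129a2 ≅ E_{41}`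
(field `d_K = -8`, Heegner for `3·41`, (1)–(3) kernel theorems).
[cite: KrizLi2019, Thm. 1.23 = Thm. 10.10 and Cor. 10.7 (2)] [cite: AgasheRibetStein2006, Thm. 5.2 (appendix)] [cite: Cremona1997, Table 1 (class 15129a)] -/
theorem bsdp_three_cremona15129a_of_cor107 (h : thm1010_bsdThree_overK_sexticTwist)
    (h107 : cor107_analyticRank_sexticTwist)
    (hGZ : ∀ (K : Type) [Field K] [NumberField K], gross_zagier 15129 cremona15129a2 K)
    (hKo : ∀ (K : Type) [Field K] [NumberField K], kolyvagin 15129 cremona15129a2 K)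
    (hrat : ∀ (K : Type) [Field K] [NumberField K],
      heegnerPointComplex_mem_range_map 15129 cremona15129a2 K)
    (hCM0 : bsdTriple_of_hasCM_of_L_one_ne_zero) (hmod : hasEntireLFunction_rat)
    (hCassels : bsdRHS_eq_of_isIsogenous)
    (hDt : ∃ Dt : ModularParametrizationData cremona15129a2 15129, ¬ (3 : ℤ) ∣ Dt.c)
    (hN : cremona15129a2.conductorNorm ℤ = 15129)
    (htam : padicValNat 3 cremona15129a2Tw.tamagawaProduct = padicValNat 3 cremona15129a2.tamagawaProduct) :
    (cremona15129a2.mordellWeilRank = 1 ∧ BSDp cremona15129a2 3) ∧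
      (cremona15129a1.analyticRank = 1 ∧ BSDp cremona15129a1 3) := by
  haveI : NeZero (15129 : ℕ) := ⟨by norm_num⟩
  obtain ⟨K, _, _, h2, hD⟩ := exists_field_discr_neg8
  have hK : IsImaginaryQuadratic K :=
    ⟨h2, Quadratic.isTotallyComplex_of_discr_neg h2 (by rw [hD]; norm_num)⟩
  have hr : cremona15129a1.analyticRank = 1 :=
    analyticRank_eq_one_of_cor107_of_isIsogenous h107 (41) K isIsogenous_cremona15129a cremona15129a2_eq hK
      (by simpa using heegner123_of_discr_15129a h2 hD)
      (Or.inl ⟨by norm_num, by exact_mod_cast squarefree_intCast_of_prime (by norm_num : Nat.Prime 41),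
        by norm_num⟩)
      (by norm_num)
      (fun _ => ⟨by norm_num; exact threeClassNumberTrivial_neg123,
        by rw [hD]; norm_num; exact threeClassNumberTrivial_neg328⟩) (fun h => absurd h (by norm_num))
      (by norm_num)
  exact bsdp_three_cremona15129a_closed h hGZ hKo (fun K _ _ => nonempty_heegnerDatum_holds 15129 K) hrat hCM0
    hmod hCassels hDt hN htam hr

end Literature.NumberTheory.EllipticCurves.Rank1Residual.X12SexticTwist

end
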